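import Mathlib
import Summits.Ventures.HodgeRepro2.T6N2ToyIsoS
import Summits.Ventures.HodgeRepro2.T6N3Main2

/-!
# T6N2RatForm — ℚ-RATIONAL admissible sets for the N2 datum: the host's reading of the admissible
Schwartz data (STATUS l. 11271 (2)) as an object of the kernel (owner t6-p5)

The word of record on the host's admissible sets (t6-p5 STATUS l. 11271 (2), answering t6-lead
l. 11255 (3)(b)): the admissible choices of TIER4 B7(b) / Lemma A7.3(b) are the ℚ-RATIONAL
homomorphisms, a ℚ-vector space whose image under Liu's identification is a ℚ-FORM of the `K`-fixed
Schwartz data of each line — closed under ℚ-scaling and addition, ℂ-spanning, and NOT closed under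
ℂ-scaling. t6-p1's kernel obstruction (T6N1Obstruction2, p406748: `nAut2_displays_false_of_admA_smul_closed`)
refutes the v4 binder set exactly on carriers whose `admA` IS closed under ℂ-scaling; the
host-faithful sets are not, and N3's sentence `AdmSpanning` (t6-p3's T6N3Adm: the ℂ-span of each
admissible set is everything) asks only for the ℂ-span. This file makes that reading an object:

* `ratSpan S` — the ℚ-span of a set `S` of a ℂ-module (finite ℚ-linear combinations, coefficients
  cast into ℂ): `subset_ratSpan`, `zero_mem_ratSpan`, `add_mem_ratSpan`, `ratSmul_mem_ratSpan`
  (a ℚ-subspace), `ratSpan_subset_span`, `span_ratSpan` (its ℂ-span is the ℂ-span of `S`);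
* for a ℂ-basis `b`: `repr_mem_ratRange` (every coordinate of an element of `ratSpan (range b)` is
  rational) and `I_smul_basis_not_mem_ratSpan` — `I • b i ∉ ratSpan (range b)`: the ℚ-form of a
  basis is NOT closed under ℂ-scaling (`ratSpan_range_not_smul_closed`, the negation of the
  hypothesis `hsmul` of t6-p1's obstruction);
* `toyIsoQ F P 𝒟 bA bB bC bD` — the explicit-isometry N2 datum (T6N2ToyIsoS's `toyIsoSF`) with the
  four admissible sets the ℚ-forms of four ℂ-bases of the lines' Schwartz spaces: `toyIsoQ_adm`
  (N2's conclusion, no hypothesis), `toyIsoQ_admSpanning` / `toyIsoQ_admGenerating` (N3's sentence,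
  no hypothesis — so `N3iso_main₂`'s binder `hAdm` is discharged on it), and
  `toyIsoQ_admA_not_smul_closed` (the host-faithful non-closure). Together with T6N2Contract3's
  `ofNAut_toyIsoSF_admDatum₃` (any sets), this is N2's side of a joint toy over the re-cut carrier
  with ℚ-rational admissible data (t6-lead l. 11255 (3)(c)).

README §8(d): uses an L-value-free non-vanishing device: NO (TIER5 §N2, a pre-02:16Z line of
record — N2 asserts no non-vanishing — continued).
-/

namespace Summit.Ventures.HodgeRepro2.T6.N2RatForm

open Summit.Ventures.HodgeRepro2
open Summit.Ventures.HodgeRepro2.T6.N2ToyIsoS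

/-! ### The ℚ-span of a set of a ℂ-module -/

section ratSpan

variable {V : Type*} [AddCommGroup V] [Module ℂ V]

/-- THE ℚ-SPAN of a set `S` of a ℂ-module: the finite ℚ-linear combinations of elements of `S`
(coefficients cast into ℂ) — the model of the host's admissible Schwartz data of a line (a ℚ-form
of the `K`-fixed data: ℚ-closed, ℂ-spanning, not ℂ-closed). -/
def ratSpan (S : Set V) : Set V :=
  {x | ∃ l : V →₀ ℚ, (↑l.support : Set V) ⊆ S ∧ x = l.sum fun v q => (q : ℂ) • v}

variable (S : Set V)

/-- `S ⊆ ratSpan S`. -/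
theorem subset_ratSpan : S ⊆ ratSpan S := by
  classical
  intro v hv
  refine ⟨Finsupp.single v 1, ?_, ?_⟩
  · intro w hw
    rw [Finset.mem_coe, Finsupp.mem_support_iff, Finsupp.single_apply] at hw
    split_ifs at hw with h
    · exact h ▸ hv
    · exact absurd rfl hw
  · rw [Finsupp.sum_single_index] <;> simp

/-- `0 ∈ ratSpan S`. -/
theorem zero_mem_ratSpan : (0 : V) ∈ ratSpan S :=
  ⟨0, by simp, by simp⟩

/-- `ratSpan S` is closed under addition. -/
theorem add_mem_ratSpan {x y : V} (hx : x ∈ ratSpan S) (hy : y ∈ ratSpan S) :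
    x + y ∈ ratSpan S := by
  classical
  obtain ⟨l, hl, rfl⟩ := hx
  obtain ⟨m, hm, rfl⟩ := hy
  refine ⟨l + m, ?_, ?_⟩
  · refine subset_trans (Finset.coe_subset.2 Finsupp.support_add) ?_
    rw [Finset.coe_union]
    exact Set.union_subset hl hm
  · rw [Finsupp.sum_add_index']
    · intro v; simp
    · intro v q₁ q₂; push_cast; rw [add_smul]

/-- `ratSpan S` is closed under ℚ-scaling. -/
theorem ratSmul_mem_ratSpan (q : ℚ) {x : V} (hx : x ∈ ratSpan S) : (q : ℂ) • x ∈ ratSpan S := by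
  obtain ⟨l, hl, rfl⟩ := hx
  refine ⟨q • l, subset_trans (Finset.coe_subset.2 Finsupp.support_smul) hl, ?_⟩
  rw [Finsupp.smul_sum, Finsupp.sum_smul_index']
  · refine Finsupp.sum_congr fun v _ => ?_
    rw [smul_eq_mul, Rat.cast_mul, mul_smul]
  · intro v; simp

/-- `ratSpan S` is closed under negation. -/
theorem neg_mem_ratSpan {x : V} (hx : x ∈ ratSpan S) : -x ∈ ratSpan S := by
  have := ratSmul_mem_ratSpan S (-1) hx
  simpa using this

/-- Every element of `ratSpan S` is in the ℂ-span of `S`. -/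
theorem ratSpan_subset_span : ratSpan S ⊆ (Submodule.span ℂ S : Set V) := by
  rintro x ⟨l, hl, rfl⟩
  refine Submodule.sum_mem _ fun v hv => ?_
  exact Submodule.smul_mem _ _ (Submodule.subset_span (hl hv))

/-- The ℂ-span of the ℚ-span is the ℂ-span: the ℚ-form is ℂ-SPANNING exactly when `S` is. -/
theorem span_ratSpan : Submodule.span ℂ (ratSpan S) = Submodule.span ℂ S :=
  le_antisymm (Submodule.span_le.2 (ratSpan_subset_span S))
    (Submodule.span_mono (subset_ratSpan S))

end ratSpan

/-! ### The ℚ-form of a ℂ-basis is not closed under ℂ-scaling -/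

section basis

variable {V : Type*} [AddCommGroup V] [Module ℂ V] {ι : Type*} (b : Module.Basis ι ℂ V)

/-- Every coordinate (in the basis `b`) of an element of the ℚ-form `ratSpan (range b)` is a
rational number. -/
theorem repr_mem_ratRange {x : V} (hx : x ∈ ratSpan (Set.range b)) (i : ι) :
    b.repr x i ∈ (Rat.castHom ℂ).range := by
  classical
  obtain ⟨l, hl, rfl⟩ := hx
  rw [Finsupp.sum, map_sum, Finsupp.finsetSum_apply]
  refine Subring.sum_mem _ fun v hv => ?_
  obtain ⟨j, rfl⟩ := hl hv
  rw [map_smul, Finsupp.smul_apply, Module.Basis.repr_self, smul_eq_mul]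
  refine Subring.mul_mem _ ⟨l (b j), by simp⟩ ?_
  rw [Finsupp.single_apply]
  split_ifs
  · exact Subring.one_mem _
  · exact Subring.zero_mem _

/-- `I` is not rational. -/
theorem I_not_mem_ratRange : Complex.I ∉ (Rat.castHom ℂ).range := by
  rintro ⟨q, hq⟩
  have h := congrArg Complex.im hq
  simp at h

/-- `I • b i ∉ ratSpan (range b)`: the ℚ-form of a basis is not closed under ℂ-scaling. -/
theorem I_smul_basis_not_mem_ratSpan (i : ι) : Complex.I • b i ∉ ratSpan (Set.range b) := by
  intro h
  have hi := repr_mem_ratRange b h i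
  rw [map_smul, Finsupp.smul_apply, Module.Basis.repr_self, Finsupp.single_eq_same, smul_eq_mul,
    mul_one] at hi
  exact I_not_mem_ratRange hi

/-- THE HOST-FAITHFUL NON-CLOSURE: for a ℂ-basis `b` of a non-zero space, the ℚ-form
`ratSpan (range b)` is NOT closed under ℂ-scaling — the negation of the hypothesis `hsmul` of
t6-p1's `nAut2_displays_false_of_admA_smul_closed`. -/
theorem ratSpan_range_not_smul_closed [Nonempty ι] :
    ¬ ∀ (t : ℂ) (x : V), x ∈ ratSpan (Set.range b) → t • x ∈ ratSpan (Set.range b) := by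
  intro h
  obtain ⟨i⟩ := ‹Nonempty ι›
  exact I_smul_basis_not_mem_ratSpan b i
    (h Complex.I (b i) (subset_ratSpan _ ⟨i, rfl⟩))

/-- The ℚ-form of a basis is ℂ-spanning. -/
theorem span_ratSpan_range_eq_top : Submodule.span ℂ (ratSpan (Set.range b)) = ⊤ := by
  rw [span_ratSpan, Module.Basis.span_eq]

end basis

/-! ### The explicit-isometry N2 datum with ℚ-rational admissible sets -/

variable {K : Type*} [Field K] [NumberField K] [NumberField.IsCMField K]

/-- THE EXPLICIT-ISOMETRY N2 DATUM WITH ℚ-RATIONAL ADMISSIBLE SETS: `toyIsoSF` with the four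
admissible sets the ℚ-forms of ℂ-bases `bA`, `bB`, `bC`, `bD` of the lines' Schwartz spaces. -/
noncomputable def toyIsoQ (F : FaceSetting K) (P : NDatum F) (𝒟 : N3Datum)
    {ιA ιB ιC ιD : Type*} (bA : Module.Basis ιA ℂ 𝒟.A.Sa) (bB : Module.Basis ιB ℂ 𝒟.A.Sb)
    (bC : Module.Basis ιC ℂ 𝒟.B.Sa) (bD : Module.Basis ιD ℂ 𝒟.B.Sb) : N2Datum F P 𝒟 :=
  toyIsoSF F P 𝒟 (ratSpan (Set.range bA)) (ratSpan (Set.range bB)) (ratSpan (Set.range bC))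
    (ratSpan (Set.range bD))

variable (F : FaceSetting K) (P : NDatum F) (𝒟 : N3Datum)
  {ιA ιB ιC ιD : Type*} (bA : Module.Basis ιA ℂ 𝒟.A.Sa) (bB : Module.Basis ιB ℂ 𝒟.A.Sb)
  (bC : Module.Basis ιC ℂ 𝒟.B.Sa) (bD : Module.Basis ιD ℂ 𝒟.B.Sb)

/-- N2's conclusion on `toyIsoQ`, no hypothesis (the admissible sets are not seen by `Adm`). -/
theorem toyIsoQ_adm : (toyIsoQ F P 𝒟 bA bB bC bD).Adm :=
  toyIsoSF_adm F P 𝒟 _ _ _ _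

/-- The admissible sets of `toyIsoQ` are the four ℚ-forms (`rfl`). -/
theorem toyIsoQ_admA : (toyIsoQ F P 𝒟 bA bB bC bD).admA = ratSpan (Set.range bA) := rfl

/-- N3's sentence `AdmSpanning` on `toyIsoQ`, no hypothesis: each ℚ-form ℂ-spans its line. -/
theorem toyIsoQ_admSpanning : (toyIsoQ F P 𝒟 bA bB bC bD).AdmSpanning :=
  ⟨span_ratSpan_range_eq_top bA, span_ratSpan_range_eq_top bB, span_ratSpan_range_eq_top bC,
    span_ratSpan_range_eq_top bD⟩

/-- The sentence N2 and N3 share, `AdmGenerating` (the binder `hAdm` of t6-p3's `N3iso_main₂` /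
`N3iso_main₃`), on `toyIsoQ` with no hypothesis. -/
theorem toyIsoQ_admGenerating : (toyIsoQ F P 𝒟 bA bB bC bD).AdmGenerating :=
  N2Datum.admGenerating_of_admSpanning _ (toyIsoQ_admSpanning F P 𝒟 bA bB bC bD)

/-- The admissible set of line `a` of `toyIsoQ` is NOT closed under ℂ-scaling (host-faithful:
the hypothesis of t6-p1's obstruction fails on it). -/
theorem toyIsoQ_admA_not_smul_closed [Nonempty ιA] :
    ¬ ∀ (t : ℂ) (φa : 𝒟.A.Sa), φa ∈ (toyIsoQ F P 𝒟 bA bB bC bD).admA →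
      t • φa ∈ (toyIsoQ F P 𝒟 bA bB bC bD).admA :=
  ratSpan_range_not_smul_closed bA

/-- Every quadruple with coordinates in the four ℚ-forms is admissible data of `toyIsoQ`. -/
theorem toyIsoQ_admData_iff (φ : 𝒟.A.Sa × 𝒟.A.Sb × 𝒟.B.Sa × 𝒟.B.Sb) :
    (toyIsoQ F P 𝒟 bA bB bC bD).AdmData φ ↔
      φ.1 ∈ ratSpan (Set.range bA) ∧ φ.2.1 ∈ ratSpan (Set.range bB) ∧
        φ.2.2.1 ∈ ratSpan (Set.range bC) ∧ φ.2.2.2 ∈ ratSpan (Set.range bD) :=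
  Iff.rfl


/-! ### v2 APPEND — the ℚ-rational line of `ℂ` (the toys' Schwartz spaces are `ℂ`: t6-p3's
`N3Toy.toy` / `toyV` have `Sa = Sb = ℂ`): the admissible set `Set.range ((↑) : ℚ → ℂ)` of the
lead's plan of record (STATUS l. 11316 (2)/(4)) and the one-line discharge of N3's sentence on
`toyIsoSF` at such sets. -/

section ratRange

/-- THE ℚ-RATIONAL LINE OF `ℂ`: the rational numbers inside `ℂ` — the admissible set of a line whose
Schwartz space is `ℂ` (the toys), the ℚ-form of the basis `{1}`. -/
def ratRange : Set ℂ := Set.range ((↑) : ℚ → ℂ)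

/-- `q ∈ ratRange` for every rational `q`. -/
theorem ratCast_mem_ratRange (q : ℚ) : (q : ℂ) ∈ ratRange := ⟨q, rfl⟩

/-- `1 ∈ ratRange`. -/
theorem one_mem_ratRange : (1 : ℂ) ∈ ratRange := ⟨1, by simp⟩

/-- `0 ∈ ratRange`. -/
theorem zero_mem_ratRange : (0 : ℂ) ∈ ratRange := ⟨0, by simp⟩

/-- `ratRange` is the range of `Rat.castHom ℂ` (membership form). -/
theorem mem_ratRange_iff (z : ℂ) : z ∈ ratRange ↔ z ∈ (Rat.castHom ℂ).range := by
  simp [ratRange, RingHom.mem_range]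

/-- `I ∉ ratRange`. -/
theorem I_not_mem_ratRange' : Complex.I ∉ ratRange := by
  rw [mem_ratRange_iff]; exact I_not_mem_ratRange

/-- THE ℂ-SPANNING STATEMENT OF THE ℚ-LINE: `span ℂ ratRange = ⊤` (it contains `1`). This is the
binder `hAdm` of N3's sentence on a toy line, discharged. -/
theorem span_ratRange_eq_top : Submodule.span ℂ ratRange = ⊤ := by
  refine eq_top_iff.2 fun z _ => ?_
  have h1 : (1 : ℂ) ∈ Submodule.span ℂ ratRange := Submodule.subset_span one_mem_ratRange
  simpa using Submodule.smul_mem _ z h1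

/-- The ℚ-line is NOT closed under ℂ-scaling (`I • 1 = I ∉ ratRange`): the host-faithful
non-closure on a toy line, the negation of the `hsmul` binder of t6-p1's obstruction. -/
theorem ratRange_not_smul_closed :
    ¬ ∀ (t : ℂ) (x : ℂ), x ∈ ratRange → t • x ∈ ratRange := by
  intro h
  have := h Complex.I 1 one_mem_ratRange
  rw [smul_eq_mul, mul_one] at this
  exact I_not_mem_ratRange' this

/-- `ratRange` is closed under ℚ-scaling and addition (a ℚ-subspace of `ℂ`). -/
theorem ratSmul_mem_ratRange (q : ℚ) {z : ℂ} (hz : z ∈ ratRange) : (q : ℂ) • z ∈ ratRange := by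
  obtain ⟨r, rfl⟩ := hz
  exact ⟨q * r, by push_cast; rfl⟩

/-- `ratRange` is closed under addition. -/
theorem add_mem_ratRange {z w : ℂ} (hz : z ∈ ratRange) (hw : w ∈ ratRange) : z + w ∈ ratRange := by
  obtain ⟨r, rfl⟩ := hz
  obtain ⟨s, rfl⟩ := hw
  exact ⟨r + s, by push_cast; rfl⟩

/-- The ℚ-line IS the ℚ-span of `{1}` (the general theory specialised to the line). -/
theorem ratRange_eq_ratSpan_singleton_one : ratRange = ratSpan ({1} : Set ℂ) := by
  classical
  ext z
  constructor
  · rintro ⟨q, rfl⟩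
    exact ratSmul_mem_ratSpan _ q (subset_ratSpan _ (Set.mem_singleton 1)) |>.imp
      fun l hl => by simpa using hl
  · rintro ⟨l, hl, rfl⟩
    have hsub : l.support ⊆ {1} := by
      intro v hv
      exact Finset.mem_singleton.2 (hl (Finset.mem_coe.2 hv))
    rw [Finsupp.sum_of_support_subset l hsub]
    · simp only [Finset.sum_singleton, smul_eq_mul, mul_one]
      exact ratCast_mem_ratRange _
    · intro v _; simp

end ratRange

/-! ### N3's sentence on `toyIsoSF` at prescribed sets -/

/-- `AdmSpanning` of `toyIsoSF …` is the conjunction of the four ℂ-spanning statements of the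
prescribed sets (`Iff.rfl`) — so on a carrier whose lines are `ℂ` and whose admissible sets are
`ratRange`, `hAdm` is `admGenerating_of_admSpanning _ ⟨span_ratRange_eq_top, …⟩`. -/
theorem toyIsoSF_admSpanning_iff {K : Type*} [Field K] [NumberField K] [NumberField.IsCMField K]
    (F : FaceSetting K) (P : NDatum F) (𝒟 : N3Datum)
    (admA : Set 𝒟.A.Sa) (admB : Set 𝒟.A.Sb) (admC : Set 𝒟.B.Sa) (admD : Set 𝒟.B.Sb) :
    (toyIsoSF F P 𝒟 admA admB admC admD).AdmSpanning ↔
      Submodule.span ℂ admA = ⊤ ∧ Submodule.span ℂ admB = ⊤ ∧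
        Submodule.span ℂ admC = ⊤ ∧ Submodule.span ℂ admD = ⊤ :=
  Iff.rfl

/-- `AdmGenerating` (the binder `hAdm` of `N3iso_main₂` / `N3iso_main₃`) on `toyIsoSF …` from the
four ℂ-spanning statements of the prescribed sets. -/
theorem toyIsoSF_admGenerating_of_spans {K : Type*} [Field K] [NumberField K]
    [NumberField.IsCMField K] (F : FaceSetting K) (P : NDatum F) (𝒟 : N3Datum)
    (admA : Set 𝒟.A.Sa) (admB : Set 𝒟.A.Sb) (admC : Set 𝒟.B.Sa) (admD : Set 𝒟.B.Sb)
    (hA : Submodule.span ℂ admA = ⊤) (hB : Submodule.span ℂ admB = ⊤)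
    (hC : Submodule.span ℂ admC = ⊤) (hD : Submodule.span ℂ admD = ⊤) :
    (toyIsoSF F P 𝒟 admA admB admC admD).AdmGenerating :=
  N2Datum.admGenerating_of_admSpanning _ ⟨hA, hB, hC, hD⟩


/-! ### v3 APPEND — countability: the ℚ-span of a countable set is countable (the record sentence
of STATUS l. 11316 (2): «period values in a countable set» — a ℚ-multilinear form evaluated on
ℚ-rational data takes values in the ℚ-span of countably many numbers). -/

section countable

variable {V : Type*} [AddCommGroup V] [Module ℂ V]

omit [AddCommGroup V] [Module ℂ V] in
/-- The finite subsets (as `Finset`s) of a countable set form a countable set. -/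
theorem countable_finset_subset {S : Set V} (hS : S.Countable) :
    {T : Finset V | (↑T : Set V) ⊆ S}.Countable := by
  have h := Set.countable_setOf_finite_subset hS
  have hpre : {T : Finset V | (↑T : Set V) ⊆ S} =
      (fun T : Finset V => (↑T : Set V)) ⁻¹' {t | t.Finite ∧ t ⊆ S} := by
    ext T; simp [Finset.finite_toSet]
  rw [hpre]
  exact h.preimage_of_injOn Finset.coe_injective.injOn

/-- THE ℚ-SPAN OF A COUNTABLE SET IS COUNTABLE: every element is a ℚ-combination over a finite
subset, and there are countably many finite subsets and countably many ℚ-coefficient vectors on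
each. -/
theorem ratSpan_countable {S : Set V} (hS : S.Countable) : (ratSpan S).Countable := by
  classical
  let g : Finset V → Set V := fun T => Set.range fun q : (↥T) → ℚ => ∑ v : ↥T, (q v : ℂ) • (v : V)
  have hU : (⋃ T ∈ {T : Finset V | (↑T : Set V) ⊆ S}, g T).Countable :=
    (countable_finset_subset hS).biUnion fun T _ => Set.countable_range _
  refine hU.mono ?_
  rintro x ⟨l, hl, rfl⟩
  refine Set.mem_iUnion₂.2 ⟨l.support, hl, fun v => l v, ?_⟩
  simp only [Finsupp.sum]
  exact Finset.sum_coe_sort l.support fun v => (l v : ℂ) • v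

/-- The ℚ-form of a basis with a countable index set is countable (the host's admissible data of a
line: countably many). -/
theorem ratSpan_range_countable {ι : Type*} [Countable ι] (b : Module.Basis ι ℂ V) :
    (ratSpan (Set.range b)).Countable :=
  ratSpan_countable (Set.countable_range b)

/-- The ℚ-line of `ℂ` is countable. -/
theorem ratRange_countable : ratRange.Countable := Set.countable_range _

/-- The image of a countable set under any map is countable — so the values of a period functional
on ℚ-rational admissible data (countably many) form a countable set (the record's sentence). -/
theorem image_ratSpan_countable {W : Type*} {S : Set V} (hS : S.Countable) (f : V → W) :
    (f '' ratSpan S).Countable :=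
  (ratSpan_countable hS).image f

end countable

end Summit.Ventures.HodgeRepro2.T6.N2RatForm
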